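import Summits.QuantumFields.BalabanUV.T4Continuum.Support.B13TermOpEnvelope
import Summits.QuantumFields.BalabanUV.T4Continuum.Support.B13StepOfRecordActNorm
import Summits.QuantumFields.BalabanUV.T4Continuum.Support.OutputRateActOpFibre

/-!
# NE5 ∕ U3 — the CAUCHY (fibre-envelope) END FACE applied to the ASSEMBLED step model and to the model OF RECORD, with BOTH halves
# of W2 read at ACTIVITY level: the history half STRUCTURAL (`ActExpLinearOn`), the operator half the displayed factor line
# analyticity `ActOpLineAnalyticOn` — conclusion literally `T4OutputRate.NE5 outA outB W κ θ′ C₅` (typer `t4/formal/NE5/DAG.md`: a new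
# END face next to E1 `B13StepEnd` ∕ E8 `B13StepSecantEnd`)

Cell `pub-balaban`, unit `b2b-balaban-t4-ne5-formalise-leaf-03` (NE5 formalisation swarm, LEAF PROVER 03, gen 5; follower of this
lineage's `Support/B13TermOpEnvelope.lean` (operator Cauchy face at activity level) and `Support/B13TermHistEnvelope.lean` p210127,
in the pattern of the lineage's E8 `Support/B13StepSecantEnd.lean` p210428 and leaf-09's E1 `Support/B13StepEnd.lean` p208726).
Summits-side NEW WORK under the LEAN PLACEMENT RULE (cell bookkeeping; NOT a Literature module; NO owner END-face module is edited — a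
NEW module applying the tree's END `T4InputCauchyRateTermwise.ne5_at_of_stepModel_fibreCl₂_scale_nat` BY NAME).  HONEST FRAMING:
rung (B)+1 of the FINITE-VOLUME T⁴ continuum programme — NOT infinite volume, NOT a mass gap, NOT the Clay problem, and **NOT A PROOF
OF NE5**: every END below is an IMPLICATION whose wall binders — W2-op = `ActOpLineAnalyticOn` (cell GAPS G-ne5p1-1′∕1″, NOT PRINTED,
RELOCATED to the factors by `B13TermOpEnvelope`), the per-activity norm majorant ((2.38) KIND) with its per-domain budget ((2.41)∕[26]
KIND) or — on the carriers of record — its decay split and anchored norm, W1 in margin units or in row NE2's entry currency, W4, the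
one-run slice budgets (W3 KIND), the quoted one-run levels L05∕L06 ([Balaban1987RG1] (1.18) p. 263 SHAPE), the transport reading, the
numerics — are DISPLAYED HYPOTHESES, asserted nowhere (c3∕c4∕c6).  HONEST DEPENDENCY (cell line, verbatim): continuum YM on T⁴ ⇐
BetaPertH ∧ nine spine estimates (0/9 proved); BetaPertH ⇐ (D1) ∧ (D4) ∧ CAP+tail; G-an2-4 gates asym, D1 and NE2/3/4.

WHAT IS PROVED (kernel; `[folklore]`; no definition):
* §1 **`ne5_of_assembly_envelope_opRate`** — for the assembled model `𝔄.step (𝔄.bHist E₀ cB)` of row O1-e: the transport READING, the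
  displayed slice budgets of both runs, the quoted levels, W1 as `OperatorRate δ θ` (margin units), W4 as `InsertionRate`, ROOM
  `rOp ≤ ROp`, `bHist + rHist ≤ RHist`, the per-activity norm majorant `A` with per-domain budget `G` on the ball class
  `ballClass (selfCtr raw histRef) ROp RHist`, **`ActOpLineAnalyticOn` (operator half of W2, factor level) and `ActExpLinearOn` (history
  half, STRUCTURE)**, and the numerics of E1 (near hypothesis, first scales, smallness `ω + G·cA∕(1 − ρ₀) < θ′`) IMPLY
  `NE5 outA outB W κ θ′ ((G(δ + δ′)∕(1 − ρ₀) + B)(θ′ − ω)∕(θ′ − (ω + G·cA∕(1 − ρ₀))))` — EXACTLY E1's constant and smallness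
  (`B13StepEnd.ne5_of_assembly_opRate`), with E1's term-level binders `TermBound`∕`TermBudget` (X-blind) and the JOINT `TermLineAnalytic`
  REPLACED by the per-domain activity majorant∕budget, the factor-level operator half and the history STRUCTURE; MI-R, L03, L08r, L09
  and BOTH fibre envelopes (`B13TermOpEnvelope.fibreEnvelopesCl_step_of_act`) DISCHARGED inside; **`ne5_of_assembly_envelope`** — the same
  with W1 in row NE2's entry currency (`WeightedEntrywiseRate c₁ θ^k`, bounded raw suppliers, margin floor `r₀`; `δ := c₁∕r₀`).
* §2 **`ne5_of_record_envelope_actNormDecay`** — §1 at the assembly OF RECORD `B13StepOfRecord.assembly S` on Bałaban's carriers of record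
  (`B13Carriers.TwoRuns.carriers`), conclusion literally `NE5 (B13StepOfRecord.outA S E₀ cB) (B13StepOfRecord.outB S E₀ cB) W κ θ′ C₅`,
  with the per-domain budget binder DISCHARGED from the decay split `A ≤ A′·e^{−κ(d(Z)+5)}` and the anchored exponential norm `Φ′` of
  `A′` with `36Φ′ < 1` by leaf-01's `B13StepOfRecordActNorm.actBudget_record_of_actNormDecay` (geometry — locality, reach ν = 9, (2.27)
  c = 5 — THEOREMS on the carriers of record); `G := Φ′∕(1 − 36Φ′)`.
* §3 ONE FACTOR-LEVEL DATUM FOR BOTH ROUTES: **`actOpFibre_of_actOpLineAnalyticOn`** — slack `BoxInClass M K W` + the activity norm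
  majorant `A` on the class + `ActOpLineAnalyticOn 𝒯 act K W` ⟹ the OWNER's based fibre shape `OutputRateActOpFibre.ActOpFibre 𝒯 act M W A`
  (the operator segment through a base point at the base history lies in the box, hence in the class); hence
  **`opLipschitz_b13_of_actOpLineAnalyticOn`** (`⟹ OpLipschitz M W κ G₁ ρ₀` by the owner's `opLipschitz_b13_of_actOpFibre`, i.e. route P2's
  `hopL` of the SECANT ENDs E8∕E8[rec]) — so the SAME displayed factor datum (`hact`, `hA`) feeds the Cauchy END of §1∕§2 AND the secant END.
CENSUS VALUE.  Compared with E8[rec] (`B13StepOfRecordSecantEnd.ne5_of_record_secant_actNormDecay`, secant route): the OUTPUT-level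
wall binder `hopL : OpLipschitz (step S E₀ cB) W κ Λop ρ₀` is GONE — replaced by the FACTOR-level `ActOpLineAnalyticOn` on the ball
class (fed, if desired, by the owner's `TermOpHolomorphic` at the factor family, `B13TermOpEnvelope.actOpLineAnalyticOn_of_factorHolomorphic`)
— and the per-activity exponent bounds `N`∕`N̄` of the secant route do not occur (the Cauchy route needs no history modulus); what the
Cauchy route pays instead is E1's history ROOM `bHist + rHist ≤ RHist` and the reach letter `ρ₀ < 1` inside `G∕(1 − ρ₀)`.
Nothing is asserted about [II]'s kernels ∕ potentials ∕ terms (the `Slots` stay PARAMETERS).  0 sorry; axioms ⊆ {propext,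
Classical.choice, Quot.sound}.
-/

noncomputable section

open scoped BigOperators
open Metric Set

namespace Summit.QuantumFields.BalabanUV.T4Continuum.B13StepEnvelopeEnd

open Literature.MathematicalPhysics.QuantumFieldTheory.Balaban1983to89
open Literature.MathematicalPhysics.QuantumFieldTheory.Balaban1983to89.T4OutputRate (Carriers Functional DecayBound NE5)
open Literature.MathematicalPhysics.QuantumFieldTheory.Balaban1983to89.T4InputCauchyRateData (StepModel)
open Literature.MathematicalPhysics.QuantumFieldTheory.Balaban1983to89.T4InputCauchyRateSpecies (ballClass BoxInClass OpLipschitz opSegment_mem_box)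
open Literature.MathematicalPhysics.QuantumFieldTheory.Balaban1983to89.T4InputCauchyRateTermwise
  (OpFibreEnvelopeCl HistFibreEnvelopeCl ne5_at_of_stepModel_fibreCl₂_scale_nat)
open Summit.QuantumFields.BalabanUV.T4Continuum.B13Carriers (TwoRuns)
open Summit.QuantumFields.BalabanUV.T4Continuum.B13OpDatum (OpDatum)
open Summit.QuantumFields.BalabanUV.T4Continuum.B13OpDatumJunctions (RawBounded WeightedEntrywiseRate)
open Summit.QuantumFields.BalabanUV.T4Continuum.B13StepTermLabels (TermIdx InnerLabel)
open Summit.QuantumFields.BalabanUV.T4Continuum.B13StepTermFamily (ActData ActExpLinearOn)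
open Summit.QuantumFields.BalabanUV.T4Continuum.B13StepTermSocket (labelsIndexing touchInc)
open Summit.QuantumFields.BalabanUV.T4Continuum.B13InnerData (Bnd b13InnerData)
open Summit.QuantumFields.BalabanUV.T4Continuum.B13TermRep (actMajorant)
open Summit.QuantumFields.BalabanUV.T4Continuum.UrsellTreeSum (ind)
open Summit.QuantumFields.BalabanUV.T4Continuum.UrsellTermBudget (actSum)
open Summit.QuantumFields.BalabanUV.T4Continuum.B13Base (selfCtr)
open Summit.QuantumFields.BalabanUV.T4Continuum.B13Represents (Assembly)
open Summit.QuantumFields.BalabanUV.T4Continuum.B13DomainGeometryTR (SCube footprint domainGeometry)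
open Summit.QuantumFields.BalabanUV.T4Continuum.B13StepOfRecord (assembly step outA outB)
open Summit.QuantumFields.BalabanUV.T4Continuum.B13StepOfRecordActNorm (actBudget_record_of_actNormDecay)
open Summit.QuantumFields.BalabanUV.T4Continuum.B13TermOpEnvelope (ActOpLineAnalyticOn fibreEnvelopesCl_step_of_act)
open Summit.QuantumFields.BalabanUV.T4Continuum.B13StepTermFamily (TermIndexing out)
open Summit.QuantumFields.BalabanUV.T4Continuum.B13TermHistSecant (secMajorant)
open Summit.QuantumFields.BalabanUV.T4Continuum.OutputRateActOpFibre (ActOpFibre opLipschitz_b13_of_actOpFibre)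

/-! ## §1 The Cauchy END face on the assembled step model, both halves of W2 at activity level -/

section Assembled

variable {C : Carriers} {E IOp Hist ι P J Ω : Type*} [NormedAddCommGroup Hist] [NormedSpace ℂ Hist] [MeasurableSpace Ω]
  (𝔄 : Assembly C E IOp Hist ι P J)

/-- [folklore] **THE CAUCHY END FACE ON THE ASSEMBLED STEP MODEL, W1 IN MARGIN UNITS.**  For `𝔄.step (𝔄.bHist E₀ cB)` with its
recursively defined outputs `outA`∕`outB`: the transport READING; the DISPLAYED one-run slice budgets of both runs (W3 KIND); the quoted
levels L05∕L06; W1 as `OperatorRate δ θ` and W4 as `InsertionRate … δ′ θ` (displayed); ROOM `rOp ≤ ROp`, `bHist + rHist ≤ RHist`; the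
DISPLAYED per-activity norm majorant `A` of the (2.14)-terms on the ball class `ballClass (selfCtr raw histRef) ROp RHist` ((2.38) KIND)
with per-domain budget `Summable (actMajorant (A k g U) k X) ∧ Σ' ≤ G·e^{−κd(X)}` ((2.41)∕[26] KIND); **W2 at ACTIVITY level: the
operator half `ActOpLineAnalyticOn` ([analysis], displayed — the wall, RELOCATED to the factors) and the history half `ActExpLinearOn`
(STRUCTURE, leaf-08)**; and E1's numerics IMPLY `NE5 outA outB W κ θ′ ((G∕(1−ρ₀)·δ + G∕(1−ρ₀)·δ′ + B)(θ′ − ω)∕(θ′ − (ω + G∕(1−ρ₀)·cA)))`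
— the tree's `ne5_at_of_stepModel_fibreCl₂_scale_nat` with MI-R (`representsA`∕`representsB`), L03 (`Assembly.inBase`), the structural
insertion shapes + L09 (`insAffine`∕`insBlind`∕`insHomog`∕`insScaleBound`) and BOTH fibre envelopes (`fibreEnvelopesCl_step_of_act`)
DISCHARGED inside.  NOT a proof of NE5: an implication from displayed binders. -/
theorem ne5_of_assembly_envelope_opRate {W : Set (ℕ → ℝ)} {ROp RHist : ℕ → ℝ} {A : ℕ → (ℕ → ℝ) → C.BgB → P → J → ℝ}
    {Dt : ActData P J (OpDatum E) Hist Ω} {κ G EA₀ E₀ E₁ cA cB δ δ' θ θ' ρ₀ B : ℝ} {k₀ : ℕ}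
    (hT : 𝔄.TransportReads W)
    (hbB : 𝔄.SliceBudgetB W κ cB) (hbA : 𝔄.D.SliceBudget (𝔄.step (𝔄.bHist E₀ cB)) W κ cA)
    (hdA : DecayBound (𝔄.outA (𝔄.bHist E₀ cB)) W EA₀ κ) (hdB : DecayBound (𝔄.outB (𝔄.bHist E₀ cB)) W E₀ κ)
    (hop : (𝔄.step (𝔄.bHist E₀ cB)).OperatorRate W δ θ) (hins : (𝔄.step (𝔄.bHist E₀ cB)).InsertionRate W κ E₀ δ' θ)
    (hOp : ∀ k, 𝔄.rOp k ≤ ROp k) (hHist : ∀ k, 𝔄.bHist E₀ cB k + 𝔄.rHist k ≤ RHist k)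
    (hA : ∀ k, ∀ g ∈ W, ∀ (U : C.BgB) (q : OpDatum E × Hist), q ∈ ballClass (selfCtr 𝔄.raw 𝔄.histRef) ROp RHist k g U →
      ∀ X : C.Dom, C.scale X = k → ∀ i, 𝔄.𝒯.Rel k i X → ∀ m,
        ‖𝔄.act (𝔄.𝒯.poly i m) (𝔄.𝒯.lab i m) q.1 q.2‖ ≤ A k g U (𝔄.𝒯.poly i m) (𝔄.𝒯.lab i m))
    (hbud : ∀ k, ∀ g ∈ W, ∀ (U : C.BgB) (X : C.Dom), C.scale X = k →
      Summable (actMajorant 𝔄.𝒯 𝔄.inc (A k g U) k X) ∧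
        ∑' i, actMajorant 𝔄.𝒯 𝔄.inc (A k g U) k X i ≤ G * Real.exp (-(κ * C.d X)))
    (hact : ActOpLineAnalyticOn 𝔄.𝒯 𝔄.act (ballClass (selfCtr 𝔄.raw 𝔄.histRef) ROp RHist) W)
    (hexp : ActExpLinearOn 𝔄.𝒯 𝔄.act Dt (ballClass (selfCtr 𝔄.raw 𝔄.histRef) ROp RHist) W)
    (hE₀ : 0 ≤ E₀) (hE₁ : 0 < E₁) (hG : 0 ≤ G) (hcA : 0 ≤ cA) (hcB : 0 ≤ cB) (hδ : 0 ≤ δ) (hδ' : 0 ≤ δ')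
    (hθ : 0 ≤ θ) (hθθ' : θ ≤ θ') (hθ'1 : θ' ≤ 1) (hω : 0 < 𝔄.D.ω) (hω1 : 𝔄.D.ω < 1) (hρ₀ : ρ₀ < 1)
    (hnear : (δ + δ') * θ ^ k₀ + cA * (EA₀ + E₀) / (1 - 𝔄.D.ω) ≤ ρ₀) (hB : 0 ≤ B)
    (hfirst : ∀ k < k₀, EA₀ + E₀ ≤ B * θ ^ k) (hsmall : 𝔄.D.ω + G / (1 - ρ₀) * cA < θ') :
    NE5 (𝔄.outA (𝔄.bHist E₀ cB)) (𝔄.outB (𝔄.bHist E₀ cB)) W κ θ'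
      ((G / (1 - ρ₀) * δ + G / (1 - ρ₀) * δ' + B) * (θ' - 𝔄.D.ω) / (θ' - (𝔄.D.ω + G / (1 - ρ₀) * cA))) := by
  obtain ⟨hopF, hhistF⟩ := fibreEnvelopesCl_step_of_act 𝔄 (𝔄.bHist E₀ cB) hOp hHist hA hbud hact hexp
  exact ne5_at_of_stepModel_fibreCl₂_scale_nat (𝔄.representsA _ hT) (𝔄.representsB _ W)
    (Assembly.inBase hbB hdB hE₀ hcB hω.le hω1) hopF hhistF hdA hdB hop hins (𝔄.insAffine _ W) (𝔄.insBlind _ W)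
    (𝔄.insHomog _ W) (Assembly.insScaleBound hbA hω.le hE₁.le) hE₁ hG hG hδ hδ' hθ hθθ' hθ'1 hcA hω hρ₀ hnear hB hfirst hsmall

/-- [folklore] **THE CAUCHY END FACE ON THE ASSEMBLED STEP MODEL, W1 IN ROW NE2's ENTRY CURRENCY** — the same with
`OperatorRate (c₁∕r₀) θ` PRODUCED from the DISPLAYED weighted entrywise two-run species rate `c₁·θ^k` with bounded raw suppliers and the
margin floor `r₀` (leaf-09's `Assembly.operatorRate_of_weightedEntrywise`), as in E1's first face. -/
theorem ne5_of_assembly_envelope {W : Set (ℕ → ℝ)} {ROp RHist : ℕ → ℝ} {A : ℕ → (ℕ → ℝ) → C.BgB → P → J → ℝ}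
    {Dt : ActData P J (OpDatum E) Hist Ω} {κ G EA₀ E₀ E₁ cA cB c₁ r₀ δ' θ θ' ρ₀ B : ℝ} {k₀ : ℕ}
    (hT : 𝔄.TransportReads W)
    (hbB : 𝔄.SliceBudgetB W κ cB) (hbA : 𝔄.D.SliceBudget (𝔄.step (𝔄.bHist E₀ cB)) W κ cA)
    (hdA : DecayBound (𝔄.outA (𝔄.bHist E₀ cB)) W EA₀ κ) (hdB : DecayBound (𝔄.outB (𝔄.bHist E₀ cB)) W E₀ κ)
    (hRA : RawBounded 𝔄.F 𝔄.rawAt W) (hRB : RawBounded 𝔄.F 𝔄.rawB W)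
    (hwer : WeightedEntrywiseRate 𝔄.F 𝔄.rawAt 𝔄.rawB W c₁ fun k => θ ^ k) (hfl : ∀ k, r₀ ≤ 𝔄.rOp k)
    (hins : (𝔄.step (𝔄.bHist E₀ cB)).InsertionRate W κ E₀ δ' θ)
    (hOp : ∀ k, 𝔄.rOp k ≤ ROp k) (hHist : ∀ k, 𝔄.bHist E₀ cB k + 𝔄.rHist k ≤ RHist k)
    (hA : ∀ k, ∀ g ∈ W, ∀ (U : C.BgB) (q : OpDatum E × Hist), q ∈ ballClass (selfCtr 𝔄.raw 𝔄.histRef) ROp RHist k g U →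
      ∀ X : C.Dom, C.scale X = k → ∀ i, 𝔄.𝒯.Rel k i X → ∀ m,
        ‖𝔄.act (𝔄.𝒯.poly i m) (𝔄.𝒯.lab i m) q.1 q.2‖ ≤ A k g U (𝔄.𝒯.poly i m) (𝔄.𝒯.lab i m))
    (hbud : ∀ k, ∀ g ∈ W, ∀ (U : C.BgB) (X : C.Dom), C.scale X = k →
      Summable (actMajorant 𝔄.𝒯 𝔄.inc (A k g U) k X) ∧
        ∑' i, actMajorant 𝔄.𝒯 𝔄.inc (A k g U) k X i ≤ G * Real.exp (-(κ * C.d X)))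
    (hact : ActOpLineAnalyticOn 𝔄.𝒯 𝔄.act (ballClass (selfCtr 𝔄.raw 𝔄.histRef) ROp RHist) W)
    (hexp : ActExpLinearOn 𝔄.𝒯 𝔄.act Dt (ballClass (selfCtr 𝔄.raw 𝔄.histRef) ROp RHist) W)
    (hE₀ : 0 ≤ E₀) (hE₁ : 0 < E₁) (hG : 0 ≤ G) (hcA : 0 ≤ cA) (hcB : 0 ≤ cB) (hc₁ : 0 ≤ c₁) (hr₀ : 0 < r₀)
    (hδ' : 0 ≤ δ') (hθ : 0 ≤ θ) (hθθ' : θ ≤ θ') (hθ'1 : θ' ≤ 1) (hω : 0 < 𝔄.D.ω) (hω1 : 𝔄.D.ω < 1) (hρ₀ : ρ₀ < 1)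
    (hnear : (c₁ / r₀ + δ') * θ ^ k₀ + cA * (EA₀ + E₀) / (1 - 𝔄.D.ω) ≤ ρ₀) (hB : 0 ≤ B)
    (hfirst : ∀ k < k₀, EA₀ + E₀ ≤ B * θ ^ k) (hsmall : 𝔄.D.ω + G / (1 - ρ₀) * cA < θ') :
    NE5 (𝔄.outA (𝔄.bHist E₀ cB)) (𝔄.outB (𝔄.bHist E₀ cB)) W κ θ'
      ((G / (1 - ρ₀) * (c₁ / r₀) + G / (1 - ρ₀) * δ' + B) * (θ' - 𝔄.D.ω) / (θ' - (𝔄.D.ω + G / (1 - ρ₀) * cA))) :=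
  ne5_of_assembly_envelope_opRate 𝔄 hT hbB hbA hdA hdB
    (Assembly.operatorRate_of_weightedEntrywise (BHist := 𝔄.bHist E₀ cB) hRA hRB hwer hc₁ hθ hfl hr₀) hins hOp hHist hA hbud
    hact hexp hE₀ hE₁ hG hcA hcB (div_nonneg hc₁ hr₀.le) hδ' hθ hθθ' hθ'1 hω hω1 hρ₀ hnear hB hfirst hsmall

end Assembled

/-! ## §2 The Cauchy END face ON THE CARRIERS OF RECORD, per-domain budget from the anchored norm -/

section Record

variable {G : Type} [GaugeGroup G] {R : TwoRuns G} {E IOp Hist Ω : Type*} [NormedAddCommGroup Hist] [NormedSpace ℂ Hist]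
  [MeasurableSpace Ω] (S : B13StepOfRecord.Slots R E IOp Hist) (E₀ cB : ℝ)

/-- [folklore] **THE CAUCHY END FACE ON BAŁABAN's CARRIERS OF RECORD, BOTH HALVES OF W2 AT ACTIVITY LEVEL.**  §1's
`ne5_of_assembly_envelope` at `𝔄 := B13StepOfRecord.assembly S` with the per-domain budget binder DISCHARGED: the transport READING;
the DISPLAYED one-run slice budgets of both runs (W3 KIND); the quoted levels L05∕L06; W1 in row NE2's entry currency (`c₁·θ^k`, bounded
raw suppliers, margin floor `r₀`); W4 (`δ′`); ROOM `rOp ≤ ROp`, `bHist + rHist ≤ RHist`; the DISPLAYED nonnegative per-activity norm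
majorant `A` of `S.act` on the budget ball class ((2.38) KIND) with its factorwise DECAY SPLIT `A ≤ A′·e^{−κ(d(Z)+5)}` (κ ≥ 0, `A′ ≥ 0`)
and the ANCHORED exponential norm `Φ′` of `A′` on every `R.domAt k` with `36Φ′ < 1` ((2.38)+(1.26) KIND; the per-domain budget is
then leaf-01's THEOREM `actBudget_record_of_actNormDecay` — locality, reach ν = 9 and (2.27) c = 5 being theorems on the carriers of
record); **`ActOpLineAnalyticOn` for `S.act` on the ball class (W2-op at factor level, [analysis], displayed) and `ActExpLinearOn`
(W2-hist, STRUCTURE)**; and the numerics IMPLY `NE5 (outA S E₀ cB) (outB S E₀ cB) W κ θ′ C₅` with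
`C₅ = ((G(c₁∕r₀) + G·δ′)∕(1 − ρ₀) + B)(θ′ − ω)∕(θ′ − (ω + G·cA∕(1 − ρ₀)))`, `G := Φ′∕(1 − 36Φ′)`.  NOT a proof of NE5: an implication
from displayed binders. -/
theorem ne5_of_record_envelope_actNormDecay {W : Set (ℕ → ℝ)} {ROp RHist : ℕ → ℝ}
    {A A' : ℕ → (ℕ → ℝ) → R.carriers.BgB → R.carriers.Dom → InnerLabel R.carriers.Dom (Bnd R) → ℝ}
    {Dt : ActData R.carriers.Dom (InnerLabel R.carriers.Dom (Bnd R)) (OpDatum E) Hist Ω}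
    {κ Φ' EA₀ E₁ cA c₁ r₀ δ' θ θ' ρ₀ B : ℝ} {k₀ : ℕ}
    (hT : (assembly S).TransportReads W)
    (hbB : (assembly S).SliceBudgetB W κ cB) (hbA : S.D.SliceBudget (step S E₀ cB) W κ cA)
    (hdA : DecayBound (outA S E₀ cB) W EA₀ κ) (hdB : DecayBound (outB S E₀ cB) W E₀ κ)
    (hRA : RawBounded S.F (assembly S).rawAt W) (hRB : RawBounded S.F S.rawB W)
    (hwer : WeightedEntrywiseRate S.F (assembly S).rawAt S.rawB W c₁ fun k => θ ^ k) (hfl : ∀ k, r₀ ≤ S.rOp k)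
    (hins : (step S E₀ cB).InsertionRate W κ E₀ δ' θ)
    (hOp : ∀ k, S.rOp k ≤ ROp k) (hHist : ∀ k, (assembly S).bHist E₀ cB k + S.rHist k ≤ RHist k)
    (hA : ∀ k, ∀ g ∈ W, ∀ (U : R.carriers.BgB) (q : OpDatum E × Hist),
      q ∈ ballClass (selfCtr (assembly S).raw (assembly S).histRef) ROp RHist k g U → ∀ X : R.carriers.Dom, R.carriers.scale X = k →
        ∀ i : TermIdx R.carriers.Dom (Bnd R), (labelsIndexing (domainGeometry R) (b13InnerData R)).Rel k i X → ∀ m,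
          ‖S.act ((labelsIndexing (domainGeometry R) (b13InnerData R)).poly i m)
              ((labelsIndexing (domainGeometry R) (b13InnerData R)).lab i m) q.1 q.2‖ ≤
            A k g U ((labelsIndexing (domainGeometry R) (b13InnerData R)).poly i m)
              ((labelsIndexing (domainGeometry R) (b13InnerData R)).lab i m))
    (hA0 : ∀ k g U Z ℓ, 0 ≤ A k g U Z ℓ) (hA0' : ∀ k g U Z ℓ, 0 ≤ A' k g U Z ℓ) (hκ : 0 ≤ κ)
    (hdec : ∀ k g U Z ℓ, A k g U Z ℓ ≤ A' k g U Z ℓ * Real.exp (-(κ * (R.carriers.d Z + 5))))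
    (hΦ0 : 0 ≤ Φ') (hΦsmall : 36 * Φ' < 1)
    (hΦ : ∀ k, ∀ g ∈ W, ∀ (U : R.carriers.BgB) (q : SCube R),
      ∑ Z ∈ R.domAt k, ind (q ∈ footprint Z) * actSum (b13InnerData R) (A' k g U) k Z * Real.exp ((footprint Z).card) ≤ Φ')
    (hact : ActOpLineAnalyticOn (labelsIndexing (domainGeometry R) (b13InnerData R)) S.act
      (ballClass (selfCtr (assembly S).raw (assembly S).histRef) ROp RHist) W)
    (hexp : ActExpLinearOn (labelsIndexing (domainGeometry R) (b13InnerData R)) S.act Dt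
      (ballClass (selfCtr (assembly S).raw (assembly S).histRef) ROp RHist) W)
    (hE₀ : 0 ≤ E₀) (hE₁ : 0 < E₁) (hcA : 0 ≤ cA) (hcB : 0 ≤ cB) (hc₁ : 0 ≤ c₁) (hr₀ : 0 < r₀) (hδ' : 0 ≤ δ')
    (hθ : 0 ≤ θ) (hθθ' : θ ≤ θ') (hθ'1 : θ' ≤ 1) (hω : 0 < S.D.ω) (hω1 : S.D.ω < 1) (hρ₀ : ρ₀ < 1)
    (hnear : (c₁ / r₀ + δ') * θ ^ k₀ + cA * (EA₀ + E₀) / (1 - S.D.ω) ≤ ρ₀) (hB : 0 ≤ B)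
    (hfirst : ∀ k < k₀, EA₀ + E₀ ≤ B * θ ^ k) (hsmall : S.D.ω + Φ' / (1 - 36 * Φ') / (1 - ρ₀) * cA < θ') :
    NE5 (outA S E₀ cB) (outB S E₀ cB) W κ θ'
      ((Φ' / (1 - 36 * Φ') / (1 - ρ₀) * (c₁ / r₀) + Φ' / (1 - 36 * Φ') / (1 - ρ₀) * δ' + B) * (θ' - S.D.ω) /
        (θ' - (S.D.ω + Φ' / (1 - 36 * Φ') / (1 - ρ₀) * cA))) :=
  ne5_of_assembly_envelope (assembly S) hT hbB hbA hdA hdB hRA hRB hwer hfl hins hOp hHist hA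
    (actBudget_record_of_actNormDecay hκ hA0 hA0' hdec hΦ0 hΦsmall hΦ) hact hexp hE₀ hE₁
    (div_nonneg hΦ0 (by linarith)) hcA hcB hc₁ hr₀ hδ' hθ hθθ' hθ'1 hω hω1 hρ₀ hnear hB hfirst hsmall

end Record

/-! ## §3 One factor-level datum for BOTH routes: the class-form line analyticity gives the owner's based fibre shape -/

section Bridge

variable {C : Carriers} {ι P J Op Hist : Type*} [NormedAddCommGroup Op] [NormedSpace ℂ Op] [NormedAddCommGroup Hist]
  [NormedSpace ℂ Hist] {𝒯 : TermIndexing C ι P J} {inc : P → P → Prop} [DecidableRel inc] {act : P → J → Op → Hist → ℂ}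
  {M : StepModel C Op Hist}

omit [DecidableRel inc] in
/-- [folklore] **CLASS-FORM LINE ANALYTICITY ⟹ THE OWNER's BASED FIBRE SHAPE**: the slack `BoxInClass M K W`, an activity NORM majorant `A`
on the class and `ActOpLineAnalyticOn 𝒯 act K W` give `OutputRateActOpFibre.ActOpFibre 𝒯 act M W A` — the operator segment `ζ ↦ (p.1 + ζ•u, p.2)`
through a base point at the base history lies in the two-margin box (`opSegment_mem_box`), hence in the class, where the factors are line
analytic (differentiability) and dominated by `A` (the bound). -/
theorem actOpFibre_of_actOpLineAnalyticOn {K : ℕ → (ℕ → ℝ) → C.BgB → Set (Op × Hist)} {W : Set (ℕ → ℝ)}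
    {A : ℕ → (ℕ → ℝ) → C.BgB → P → J → ℝ} (hbox : BoxInClass M K W)
    (hA : ∀ k, ∀ g ∈ W, ∀ (U : C.BgB) (q : Op × Hist), q ∈ K k g U → ∀ X : C.Dom, C.scale X = k →
      ∀ i, 𝒯.Rel k i X → ∀ m, ‖act (𝒯.poly i m) (𝒯.lab i m) q.1 q.2‖ ≤ A k g U (𝒯.poly i m) (𝒯.lab i m))
    (hact : ActOpLineAnalyticOn 𝒯 act K W) : ActOpFibre 𝒯 act M W A := by
  intro k g hg U p hp X hX i hi m u hu
  have hseg : ∀ ζ ∈ closedBall (0 : ℂ) 1, (p.1 + ζ • u, p.2) ∈ K k g U :=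
    fun ζ hζ => hbox k g hg U p hp (opSegment_mem_box (mem_closedBall_self (M.rHist_pos k).le) hu hζ)
  exact ⟨hact k g hg U p.1 u p.2 hseg X hX i hi m, fun ζ hζ => hA k g hg U _ (hseg ζ hζ) X hX i hi m⟩

/-- [folklore] **… HENCE ROUTE P2's `hopL` FROM THE SAME FACTOR DATUM**: for any `M` with `M.Out = out 𝒯 inc act`, slack + activity norm
majorant (`A ≥ 0`) + `ActOpLineAnalyticOn` + d3's convergence binder + the per-domain secant budget with the universal modulus `1∕(1 − ρ₀)`
(`0 ≤ ρ₀ < 1`) ⟹ `OpLipschitz M W κ G₁ ρ₀` — the owner's `opLipschitz_b13_of_actOpFibre` with `hfib := actOpFibre_of_actOpLineAnalyticOn`.  So ONE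
displayed factor-level datum (`hact`, `hA`) feeds the CAUCHY END (§1∕§2) and the SECANT END (E8 ∕ E8[rec]) alike. -/
theorem opLipschitz_b13_of_actOpLineAnalyticOn (hM : ∀ k o h X, M.Out k o h X = out 𝒯 inc act k o h X)
    {K : ℕ → (ℕ → ℝ) → C.BgB → Set (Op × Hist)} {W : Set (ℕ → ℝ)} {ρ₀ κ G₁ : ℝ} {A : ℕ → (ℕ → ℝ) → C.BgB → P → J → ℝ}
    (hρ₀ : 0 ≤ ρ₀) (hρ₀1 : ρ₀ < 1) (hA0 : ∀ k g U Z j, 0 ≤ A k g U Z j) (hbox : BoxInClass M K W)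
    (hA : ∀ k, ∀ g ∈ W, ∀ (U : C.BgB) (q : Op × Hist), q ∈ K k g U → ∀ X : C.Dom, C.scale X = k →
      ∀ i, 𝒯.Rel k i X → ∀ m, ‖act (𝒯.poly i m) (𝒯.lab i m) q.1 q.2‖ ≤ A k g U (𝒯.poly i m) (𝒯.lab i m))
    (hact : ActOpLineAnalyticOn 𝒯 act K W)
    (hconv : ∀ k, ∀ g ∈ W, ∀ (U : C.BgB) (X : C.Dom), C.scale X = k → Summable (actMajorant 𝒯 inc (A k g U) k X))
    (hmom : ∀ k, ∀ g ∈ W, ∀ (U : C.BgB) (X : C.Dom), C.scale X = k →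
      Summable (secMajorant 𝒯 inc (fun _ _ => 1 / (1 - ρ₀)) (A k g U) k X) ∧
        ∑' i, secMajorant 𝒯 inc (fun _ _ => 1 / (1 - ρ₀)) (A k g U) k X i ≤ G₁ * Real.exp (-(κ * C.d X))) :
    OpLipschitz M W κ G₁ ρ₀ :=
  opLipschitz_b13_of_actOpFibre inc hM hρ₀ hρ₀1 hA0 (actOpFibre_of_actOpLineAnalyticOn hbox hA hact) hconv hmom

end Bridge

end Summit.QuantumFields.BalabanUV.T4Continuum.B13StepEnvelopeEnd

end
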